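/-
Copyright (c) 2026. All rights reserved.
Released under Apache 2.0 license as described in the file LICENSE.
-/
import Summits.HodgeConjecture.HodgeConjecture.Theorems.K2E1ResidueUniformMajorantCMTwo          -- ★ p858880 (K2E4-p14 g7) (R-b): smear/average/reduction chain, `norm_eisensteinSeriesU_flatSectionU_const_ofReal`
import Summits.HodgeConjecture.HodgeConjecture.Theorems.K2E1BLEisensteinInWeightedSpaceU2Weights  -- ★ p858854 (this seat) FILE C: `memLp_two_withDensity_supHeight_of_norm_le_mul_pow`, `supHeight_eq_ciSup_arithmetic`, `exists_pos_forall_le_supHeight_cm`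
import Summits.HodgeConjecture.HodgeConjecture.Theorems.K2E1BLIotaBoundU2                        -- ★ p858831 (K2E1-p08) `measurable_supHeight` (the weight letter `hw`, discharged)
import Summits.HodgeConjecture.HodgeConjecture.Theorems.K2E1TruncatedEisensteinL2                 -- ★ `measurable_quotFun_of_measurable` (Borel descent along the closed `G(F)`)
import HarnessLib

/-!
# EIS-R7-BL-SPH-2 (b1), LETTER-FREE: `E(φ₀H^z, ·) ∈ 𝓗_k(𝔛)` for `1 < Re z ≤ k` on `U(1,1)_{L/L⁺}` (CM pair)

Campaign EIS-R7-BL-SPH-2 (Bernstein–Lapid, arXiv:1911.02342, on `quasiSplit L⁺ L c 2`), step (b1) of the dealer's list: the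
spherical Borel Eisenstein series `E(φ₀H^z, g) = φ₀·Σ_{γ ∈ B(F)∖G(F)} H(γg)^z` lies in the weighted space
`𝓗_k(𝔛) = L²(𝔛, w₁^{−2k} dμ)` of ★ leaf `K2E1BLBorelSpacesU2Defs.HX` for every `z` with `1 < Re z ≤ k`, with BOTH letters of
★ FILE C `memLp_two_withDensity_supHeight_of_norm_le_mul_pow` discharged:

* `hw` (measurability of `w₁ = supHeight`) ← ★ `K2E1BLIotaBoundU2.measurable_supHeight`;
* `hmod` (moderate growth `‖E(φ₀H^z)(g̃⁻¹)‖ ≤ C·w₁^k`) ← THIS FILE, §2: the **uniform majorant on a compact range of exponents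
  away from the pole**, `‖E(φ₀H^z)(g)‖ ≤ ‖φ₀‖·C(σ₁, σ₂)·w₁(g)^{σ₂}` for all `z` with `σ₁ ≤ Re z ≤ σ₂` (`1 < σ₁`), obtained by
  re-running the road of ★ (R-b) `residue_uniform_majorant_cm_two` BY NAME (★ `exists_reduction_ray_cm` `γ₀g = t·k`, ★
  `exists_isCompact_smear_set_ray`, ★ `exists_smear_borelHeight`, ★ `tsum_borelHeight_rpow_le_of_borelConstantTerm` — the average of
  the positive series over `𝓕·t` against the constant term `H(t)^σ + c(σ)H(t)^{1−σ}` of ★ `borelConstantTerm_sphericalEisenstein_cm_two` ∘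
  ★ W5-B `sphericalConstantTerm_continuation`), the factor `(σ − 1)` of (R-b) being replaced by the bound `‖c(σ)‖ ≤ M` on `[σ₁, σ₂]`
  (W5-B: `c` is holomorphic on `{1/2 < Re} ∖ {1}`, hence continuous on the compact segment), and the complex exponent being reduced
  to the real one termwise (`|H^z| = H^{Re z}`, §1).

§3 then gives the head `eisensteinSeriesU_flatSectionU_memHX_cm_two` (the `MemLp` fact that ★ leaf `toHX` consumes), the generic
`L²(w₁^{−2k}dμ)`-norm bound `eLpNorm_le_of_norm_le_mul_supHeight_pow` from a pointwise `‖Φ‖ ≤ C·w₁^k`, and the norm bound of the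
element `toHX k μ E(φ₀H^z)` UNIFORM in `z` on `{σ₁ ≤ Re z ≤ k}` (`norm_toHX_eisensteinSeriesU_le_uniform_cm_two`) — the input of
(b2) (holomorphy of `z ↦ ι E(z)` by dominated convergence).

All constants are explicit; the measure `μ` on `𝔛` is only assumed finite. Count-neutral helper (supports h413 =
stmt-HodgeConjecture-24833); HC_CM stays proved only modulo its printed citations.

References: [cite: BernsteinLapid2019, §4 (p. 10), §7] (arXiv:1911.02342); [cite: MoeglinWaldspurger1995, I.2.2, II.1.5, IV.1.8];
[cite: Garrett2018, §2.3, §3.10]; [cite: Rogawski1990, §2.2].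
-/

open MeasureTheory Measure NumberField IsDedekindDomain Set Filter Module MulAction
open scoped ENNReal NNReal Topology
open Literature.NumberTheory.Automorphic Literature.NumberTheory.Automorphic.UnitaryGroup AdelicGroupData
open Summit.HodgeConjecture.HodgeConjecture.Cruxes.H413.K2E1BorelEisensteinU
open Summit.HodgeConjecture.HodgeConjecture.Cruxes.H413.K2E1ResidueUniformMajorantCMTwo
open Summit.HodgeConjecture.HodgeConjecture.Cruxes.H413.K2E1SphericalConstantTermContinuationU2 (sphericalConstantTerm_continuation)
open Summit.HodgeConjecture.HodgeConjecture.Cruxes.H413.K2E1SphericalEisensteinContinuationU2Final (borelConstantTerm_sphericalEisenstein_cm_two)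
open Summit.HodgeConjecture.HodgeConjecture.Cruxes.H413.K2E1BorelEisensteinGodementCMTwo (summable_borelHeight_rpow_cm_two)
open Summit.HodgeConjecture.HodgeConjecture.Cruxes.H413.K2E1BorelEisensteinRegularU (continuous_eisensteinSeriesU_flatSectionU_cm_two)
open Summit.HodgeConjecture.HodgeConjecture.Cruxes.H413.K2E1BorelEisensteinGodementU (exists_smear_borelHeight)
open Summit.HodgeConjecture.HodgeConjecture.Cruxes.H413.K2E1BLHeightCosetsU2 (borelHeight_mul_le_ciSup)
open Summit.HodgeConjecture.HodgeConjecture.Cruxes.H413.K2E1BLReductionCoveringU2 (exists_reduction_ray_cm exists_pos_forall_lt_ciSup_borelHeight_mul_cm)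
open Summit.HodgeConjecture.HodgeConjecture.Cruxes.H413.K2E1BLEisensteinInWeightedSpaceU2Weights (memLp_two_withDensity_supHeight_of_norm_le_mul_pow supHeight_eq_ciSup_arithmetic exists_pos_forall_le_supHeight_cm)
open Summit.HodgeConjecture.HodgeConjecture.Cruxes.H413.K2E1BLIotaBoundU2 (measurable_supHeight)
open Summit.HodgeConjecture.HodgeConjecture.Cruxes.H413.K2E1TruncatedEisensteinL2 (measurable_quotFun_of_measurable)

namespace Summit.HodgeConjecture.HodgeConjecture.Cruxes.H413.K2E1BLEisensteinMemHXCMTwo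

/-! ## §0 Bookkeeping of the constants (pure real arithmetic) -/

/-- **BOOKKEEPING.**  From `S ≤ A^σ·(H^σ + n·H^{1−σ})` with `1 < σ₁ ≤ σ ≤ σ₂`, `A ≥ 1`, `0 ≤ n ≤ M`, `0 < h₀ ≤ H ≤ A·w`, `0 < c₁ ≤ w`:
`S ≤ A^{σ₂}·(A^{σ₂}·(1 + (A c₁)^{σ₁−σ₂}) + M·(h₀^{1−σ₁} + h₀^{1−σ₂})·c₁^{−σ₂})·w^{σ₂}` — a constant depending on the RANGE `[σ₁, σ₂]` only.
[cite: MoeglinWaldspurger1995, II.1.5] -/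
theorem compact_majorant_arith {σ σ₁ σ₂ A n M h₀ c₁ H w S : ℝ} (h1 : 1 < σ₁) (hσ₁ : σ₁ ≤ σ) (hσ₂ : σ ≤ σ₂) (hA : 1 ≤ A)
    (hn : 0 ≤ n) (hnM : n ≤ M) (hh₀ : 0 < h₀) (hHt : h₀ ≤ H) (hHw : H ≤ A * w) (hc₁ : 0 < c₁) (hw : c₁ ≤ w)
    (hS : S ≤ A ^ σ * (H ^ σ + n * H ^ (1 - σ))) :
    S ≤ A ^ σ₂ * (A ^ σ₂ * (1 + (A * c₁) ^ (σ₁ - σ₂)) + M * (h₀ ^ (1 - σ₁) + h₀ ^ (1 - σ₂)) * c₁⁻¹ ^ σ₂) * w ^ σ₂ := by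
  have hw0 : 0 < w := hc₁.trans_le hw
  have hH0 : 0 < H := hh₀.trans_le hHt
  have hA0 : 0 < A := one_pos.trans_le hA
  have hAc : 0 < A * c₁ := mul_pos hA0 hc₁
  have hM : 0 ≤ M := hn.trans hnM
  have hX : 0 ≤ (A * c₁) ^ (σ₁ - σ₂) := Real.rpow_nonneg hAc.le _
  have hP : 0 ≤ A ^ σ₂ := Real.rpow_nonneg hA0.le _
  have hW : 0 ≤ w ^ σ₂ := Real.rpow_nonneg hw0.le _
  have hY1 : 0 ≤ h₀ ^ (1 - σ₁) := Real.rpow_nonneg hh₀.le _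
  have hY2 : 0 ≤ h₀ ^ (1 - σ₂) := Real.rpow_nonneg hh₀.le _
  have hZ : 0 ≤ c₁⁻¹ ^ σ₂ := Real.rpow_nonneg (inv_nonneg.2 hc₁.le) _
  -- `A^σ ≤ A^{σ₂}`
  have a1 : A ^ σ ≤ A ^ σ₂ := Real.rpow_le_rpow_of_exponent_le hA hσ₂
  -- `H^σ ≤ (A w)^σ ≤ (1 + (A c₁)^{σ₁−σ₂})·A^{σ₂}·w^{σ₂}`
  have a2 : H ^ σ ≤ (A * w) ^ σ := Real.rpow_le_rpow hH0.le hHw (by linarith)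
  have a3 : (A * w) ^ (σ - σ₂) ≤ 1 + (A * c₁) ^ (σ₁ - σ₂) := by
    have h : (A * w) ^ (σ - σ₂) ≤ (A * c₁) ^ (σ - σ₂) :=
      Real.rpow_le_rpow_of_nonpos hAc (mul_le_mul_of_nonneg_left hw hA0.le) (by linarith)
    refine h.trans ?_
    rcases le_or_gt 1 (A * c₁) with hge | hlt
    · exact (Real.rpow_le_one_of_one_le_of_nonpos hge (by linarith)).trans (le_add_of_nonneg_right hX)
    · exact (Real.rpow_le_rpow_of_exponent_ge hAc hlt.le (by linarith)).trans (le_add_of_nonneg_left zero_le_one)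
  have a4 : H ^ σ ≤ (1 + (A * c₁) ^ (σ₁ - σ₂)) * (A ^ σ₂ * w ^ σ₂) := by
    have hsplit : (A * w) ^ σ = (A * w) ^ σ₂ * (A * w) ^ (σ - σ₂) := by
      rw [← Real.rpow_add (mul_pos hA0 hw0)]; congr 1; ring
    rw [← Real.mul_rpow hA0.le hw0.le]
    calc H ^ σ ≤ (A * w) ^ σ := a2
      _ = (A * w) ^ σ₂ * (A * w) ^ (σ - σ₂) := hsplit
      _ ≤ (A * w) ^ σ₂ * (1 + (A * c₁) ^ (σ₁ - σ₂)) := mul_le_mul_of_nonneg_left a3 (Real.rpow_nonneg (mul_pos hA0 hw0).le _)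
      _ = (1 + (A * c₁) ^ (σ₁ - σ₂)) * (A * w) ^ σ₂ := mul_comm _ _
  -- `H^{1−σ} ≤ h₀^{1−σ} ≤ h₀^{1−σ₁} + h₀^{1−σ₂}`
  have a5 : H ^ (1 - σ) ≤ h₀ ^ (1 - σ₁) + h₀ ^ (1 - σ₂) := by
    have h : H ^ (1 - σ) ≤ h₀ ^ (1 - σ) := Real.rpow_le_rpow_of_nonpos hh₀ hHt (by linarith)
    refine h.trans ?_
    rcases le_or_gt 1 h₀ with hge | hlt
    · exact (Real.rpow_le_rpow_of_exponent_le hge (by linarith : 1 - σ ≤ 1 - σ₁)).trans (le_add_of_nonneg_right hY2)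
    · exact (Real.rpow_le_rpow_of_exponent_ge hh₀ hlt.le (by linarith : 1 - σ₂ ≤ 1 - σ)).trans (le_add_of_nonneg_left hY1)
  -- `1 ≤ c₁^{−σ₂}·w^{σ₂}`
  have a6 : 1 ≤ c₁⁻¹ ^ σ₂ * w ^ σ₂ := by
    rw [← Real.mul_rpow (inv_nonneg.2 hc₁.le) hw0.le]
    exact Real.one_le_rpow (by rw [inv_mul_eq_div, le_div_iff₀ hc₁, one_mul]; exact hw) (by linarith)
  -- assemble
  have hT : H ^ σ + n * H ^ (1 - σ) ≤ (A ^ σ₂ * (1 + (A * c₁) ^ (σ₁ - σ₂)) + M * (h₀ ^ (1 - σ₁) + h₀ ^ (1 - σ₂)) * c₁⁻¹ ^ σ₂) * w ^ σ₂ := by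
    have h1' : n * H ^ (1 - σ) ≤ M * (h₀ ^ (1 - σ₁) + h₀ ^ (1 - σ₂)) :=
      mul_le_mul hnM a5 (Real.rpow_nonneg hH0.le _) hM
    have h2' : M * (h₀ ^ (1 - σ₁) + h₀ ^ (1 - σ₂)) ≤ M * (h₀ ^ (1 - σ₁) + h₀ ^ (1 - σ₂)) * (c₁⁻¹ ^ σ₂ * w ^ σ₂) :=
      le_mul_of_one_le_right (mul_nonneg hM (add_nonneg hY1 hY2)) a6
    calc H ^ σ + n * H ^ (1 - σ) ≤ (1 + (A * c₁) ^ (σ₁ - σ₂)) * (A ^ σ₂ * w ^ σ₂) + M * (h₀ ^ (1 - σ₁) + h₀ ^ (1 - σ₂)) * (c₁⁻¹ ^ σ₂ * w ^ σ₂) :=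
          add_le_add a4 (h1'.trans h2')
      _ = (A ^ σ₂ * (1 + (A * c₁) ^ (σ₁ - σ₂)) + M * (h₀ ^ (1 - σ₁) + h₀ ^ (1 - σ₂)) * c₁⁻¹ ^ σ₂) * w ^ σ₂ := by ring
  have hT0 : 0 ≤ H ^ σ + n * H ^ (1 - σ) := add_nonneg (Real.rpow_nonneg hH0.le _) (mul_nonneg hn (Real.rpow_nonneg hH0.le _))
  calc S ≤ A ^ σ * (H ^ σ + n * H ^ (1 - σ)) := hS
    _ ≤ A ^ σ₂ * ((A ^ σ₂ * (1 + (A * c₁) ^ (σ₁ - σ₂)) + M * (h₀ ^ (1 - σ₁) + h₀ ^ (1 - σ₂)) * c₁⁻¹ ^ σ₂) * w ^ σ₂) := mul_le_mul a1 hT hT0 hP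
    _ = A ^ σ₂ * (A ^ σ₂ * (1 + (A * c₁) ^ (σ₁ - σ₂)) + M * (h₀ ^ (1 - σ₁) + h₀ ^ (1 - σ₂)) * c₁⁻¹ ^ σ₂) * w ^ σ₂ := by ring

variable (L : Type) [Field L] [NumberField L] [IsCMField L]

/-! ## §1 Complex exponent versus real exponent: `‖E(φ₀H^z)(g)‖ ≤ ‖φ₀‖·Σ_q H(γ̃_q g)^{Re z}` -/

/-- **`‖E(φ₀H^z)(g)‖ ≤ ‖φ₀‖·Σ_q H(γ̃_q g)^{Re z}`** for `Re z > 1`: termwise `|φ₀·H^z| = |φ₀|·H^{Re z}` (`H > 0`), norm of the sum at most the sum of the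
norms (★ Godement CM-two `summable_borelHeight_rpow_cm_two`). [cite: MoeglinWaldspurger1995, II.1.5] [cite: Garrett2018, §3.10] -/
theorem norm_eisensteinSeriesU_flatSectionU_const_le (φ₀ : ℂ) {z : ℂ} (hz : 1 < z.re) (g : (quasiSplit (↥(maximalRealSubfield L)) L (IsCMField.complexConj L) 2).Adelic) :
    ‖eisensteinSeriesU (flatSectionU (fun _ : (quasiSplit (↥(maximalRealSubfield L)) L (IsCMField.complexConj L) 2).Adelic => φ₀) z) g‖ ≤ ‖φ₀‖ * (∑' q : Quotient (MulAction.orbitRel ↥(borelU ((IsCMField.complexConj L : L ≃ₐ[↥(maximalRealSubfield L)] L) : L →+* L) ((StdForm.antidiagonal 2).over L)) ↥(unitaryGroupOfForm ((IsCMField.complexConj L : L ≃ₐ[↥(maximalRealSubfield L)] L) : L →+* L) ((StdForm.antidiagonal 2).over L))), ((borelHeight (((quasiSplit (↥(maximalRealSubfield L)) L (IsCMField.complexConj L) 2).toAdelic (Quotient.out q : ↥(unitaryGroupOfForm ((IsCMField.complexConj L : L ≃ₐ[↥(maximalRealSubfield L)] L) : L →+* L) ((StdForm.antidiagonal 2).over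 L)))) * (g)) : ℝ)) ^ z.re) := by
  have hs := summable_borelHeight_rpow_cm_two L hz g
  have hterm : ∀ q : Quotient (MulAction.orbitRel ↥(borelU ((IsCMField.complexConj L : L ≃ₐ[↥(maximalRealSubfield L)] L) : L →+* L) ((StdForm.antidiagonal 2).over L)) ↥(unitaryGroupOfForm ((IsCMField.complexConj L : L ≃ₐ[↥(maximalRealSubfield L)] L) : L →+* L) ((StdForm.antidiagonal 2).over L))), ‖(fun _ : (quasiSplit (↥(maximalRealSubfield L)) L (IsCMField.complexConj L) 2).Adelic => φ₀) (((quasiSplit (↥(maximalRealSubfield L)) L (IsCMField.complexConj L) 2).toAdelic (Quotient.out q : ↥(unitaryGroupOfForm ((IsCMField.complexConj L : L ≃ₐ[↥(maximalRealSubfield L)] L) : L →+* L) ((StdForm.antidiagonal 2).over L)))) * g) *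
      (((borelHeight (((quasiSplit (↥(maximalRealSubfield L)) L (IsCMField.complexConj L) 2).toAdelic (Quotient.out q : ↥(unitaryGroupOfForm ((IsCMField.complexConj L : L ≃ₐ[↥(maximalRealSubfield L)] L) : L →+* L) ((StdForm.antidiagonal 2).over L)))) * (g)) : ℝ)) : ℂ) ^ z‖ = ‖φ₀‖ * ((borelHeight (((quasiSplit (↥(maximalRealSubfield L)) L (IsCMField.complexConj L) 2).toAdelic (Quotient.out q : ↥(unitaryGroupOfForm ((IsCMField.complexConj L : L ≃ₐ[↥(maximalRealSubfield L)] L) : L →+* L) ((StdForm.antidiagonal 2).over L)))) * (g)) : ℝ)) ^ z.re := fun q => by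
    rw [norm_mul, Complex.norm_cpow_eq_rpow_re_of_pos (by exact_mod_cast borelHeight_pos _)]
  rw [eisensteinSeriesU_flatSectionU, ← tsum_mul_left]
  exact (norm_tsum_le_tsum_norm ((hs.mul_left ‖φ₀‖).congr fun q => (hterm q).symm)).trans_eq (tsum_congr hterm)

variable [MeasurableSpace (quasiSplit (↥(maximalRealSubfield L)) L (IsCMField.complexConj L) 2).Adelic] [BorelSpace (quasiSplit (↥(maximalRealSubfield L)) L (IsCMField.complexConj L) 2).Adelic]

/-! ## §2 The uniform majorant on a compact range of exponents away from the pole -/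

/-- **UNIFORM MAJORANT OF THE POSITIVE SERIES ON `[σ₁, σ₂] ⊂ (1, ∞)`.**  For `1 < σ₁ ≤ σ₂` there is `C = C(σ₁, σ₂) ≥ 0` with
`Σ_q H(γ̃_q g)^σ ≤ C·w₁(g)^{σ₂}` for all `σ ∈ [σ₁, σ₂]` and all `g ∈ G(𝔸)`, `w₁(g) = sup_{γ ∈ G(F)} H(γg)`.  Road of ★ (R-b)
`residue_uniform_majorant_cm_two`: reduce `γ₀ g = t·k` (★ `exists_reduction_ray_cm`), smear over the compact set of the ray (★
`exists_isCompact_smear_set_ray`, ★ `exists_smear_borelHeight`), average the positive series over `𝓕·t` against the constant term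
`H(t)^σ + c(σ)H(t)^{1−σ}` (★ `tsum_borelHeight_rpow_le_of_borelConstantTerm`, ★ `borelConstantTerm_sphericalEisenstein_cm_two`, ★ W5-B
`sphericalConstantTerm_continuation`), with `‖c(σ)‖ ≤ M` on the compact segment (W5-B: `c` holomorphic on `{1/2 < Re} ∖ {1}`) in place of the
residue bound, and §0 bookkeeping (`h₀ ≤ H(t) ≤ A₀·w₁(g)`, `w₁ ≥ c₁` ★ `exists_pos_forall_lt_ciSup_borelHeight_mul_cm`).
[cite: MoeglinWaldspurger1995, I.2.2, II.1.5, IV.1.8] [cite: Garrett2018, §2.3] [cite: BernsteinLapid2019, §7] -/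
theorem tsum_borelHeight_rpow_le_uniform_cm_two {δ : L} (hcδ : IsCMField.complexConj L δ = -δ) (hδ : δ ≠ 0)
    (ν : Measure ↥(adelicUnipotent (↥(maximalRealSubfield L)) L (IsCMField.complexConj L) 2)) [ν.IsHaarMeasure] {𝓕 : Set ↥(adelicUnipotent (↥(maximalRealSubfield L)) L (IsCMField.complexConj L) 2)} (h𝓕N : IsFundamentalDomain ↥(rationalUnipotent (↥(maximalRealSubfield L)) L (IsCMField.complexConj L) 2) 𝓕 ν) (h𝓕c : IsCompact (closure 𝓕)) {σ₁ σ₂ : ℝ} (h1 : 1 < σ₁) :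
    ∃ C : ℝ, 0 ≤ C ∧ ∀ σ : ℝ, σ₁ ≤ σ → σ ≤ σ₂ → ∀ g : (quasiSplit (↥(maximalRealSubfield L)) L (IsCMField.complexConj L) 2).Adelic, (∑' q : Quotient (MulAction.orbitRel ↥(borelU ((IsCMField.complexConj L : L ≃ₐ[↥(maximalRealSubfield L)] L) : L →+* L) ((StdForm.antidiagonal 2).over L)) ↥(unitaryGroupOfForm ((IsCMField.complexConj L : L ≃ₐ[↥(maximalRealSubfield L)] L) : L →+* L) ((StdForm.antidiagonal 2).over L))), ((borelHeight (((quasiSplit (↥(maximalRealSubfield L)) L (IsCMField.complexConj L) 2).toAdelic (Quotient.out q : ↥(unitaryGroupOfForm ((IsCMField.complexConj L : L ≃ₐ[↥(maximalRealSubfield L)] L) : L →+* L) ((StdForm.antidiagonal 2).over L)))) * (g)) : ℝ)) ^ σ) ≤ C * (((⨆ γ : (quasiSplit (↥(maximalRealSubfield L)) L (IsCMField.complexConj L) 2).arithmeticSubgroup, borelHeight ((γ : (quasiSplit (↥(maximalRealSubfield L)) L (IsCMField.complexConj L) 2).Adelic) * g)) : ℝ≥0) : ℝ) ^ σ₂ :=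 by
  -- ★ W5-B: the constant-term function `c`, holomorphic off the pole, hence bounded on `[σ₁, σ₂]`
  obtain ⟨c, r, -, -, hcd, -, hceq⟩ := sphericalConstantTerm_continuation L hcδ hδ ν h𝓕N h𝓕c
  obtain ⟨M, hM0, hM⟩ : ∃ M : ℝ, 0 ≤ M ∧ ∀ σ : ℝ, σ₁ ≤ σ → σ ≤ σ₂ → ‖c ((σ : ℝ) : ℂ)‖ ≤ M := by
    have hcont : ContinuousOn (fun σ : ℝ => c ((σ : ℝ) : ℂ)) (Icc σ₁ σ₂) := by
      refine hcd.continuousOn.comp Complex.continuous_ofReal.continuousOn fun σ hσ => ⟨?_, ?_⟩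
      · show (1 : ℝ) / 2 < (((σ : ℝ) : ℂ)).re
        rw [Complex.ofReal_re]; linarith [hσ.1]
      · rw [mem_singleton_iff]
        intro h
        have h' := congrArg Complex.re h
        rw [Complex.ofReal_re, Complex.one_re] at h'
        linarith [hσ.1]
    obtain ⟨M, hM⟩ := isCompact_Icc.exists_bound_of_continuousOn hcont
    exact ⟨max M 0, le_max_right _ _, fun σ hσ₁' hσ₂' => (hM σ ⟨hσ₁', hσ₂'⟩).trans (le_max_left _ _)⟩
  -- ★ BL-R1: reduction to the ray; the compact smearing set; ★ smear constant `A₀ ≥ 1`; `w₁ ≥ c₁ > 0`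
  obtain ⟨r₀, Kq, hKq, hred⟩ := exists_reduction_ray_cm L
  obtain ⟨Cs, hCs, hKqCs, hfac⟩ := exists_isCompact_smear_set_ray L r₀ hKq h𝓕c
  obtain ⟨A₀, hA₀, hsmear⟩ := exists_smear_borelHeight (fun g => exists_mem_borelAdelic_mul_mem_standardMaximalCompactGL_cm L g) hCs
  obtain ⟨c₁, hc₁, hw₁⟩ := exists_pos_forall_lt_ciSup_borelHeight_mul_cm L
  -- the height floor `h₀` of the ray
  obtain ⟨h₀, hh₀def⟩ : ∃ h₀ : ℝ, h₀ = (((r₀ : ℝ≥0) : ℝ)) ^ Module.finrank ℚ L * (borelHeight (1 : (quasiSplit (↥(maximalRealSubfield L)) L (IsCMField.complexConj L) 2).Adelic) : ℝ) := ⟨_, rfl⟩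
  have hr₀ : (0 : ℝ) < ((r₀ : ℝ≥0) : ℝ) := by exact_mod_cast pos_iff_ne_zero.2 r₀.ne_zero
  have hh₀ : 0 < h₀ := by
    rw [hh₀def]
    exact mul_pos (pow_pos hr₀ _) (by exact_mod_cast borelHeight_pos (1 : (quasiSplit (↥(maximalRealSubfield L)) L (IsCMField.complexConj L) 2).Adelic))
  have hA₀' : (1 : ℝ) ≤ (A₀ : ℝ) := by exact_mod_cast hA₀
  have hc₁' : (0 : ℝ) < (c₁ : ℝ) := by exact_mod_cast hc₁
  have hK0 : 0 ≤ (A₀ : ℝ) ^ σ₂ * ((A₀ : ℝ) ^ σ₂ * (1 + ((A₀ : ℝ) * (c₁ : ℝ)) ^ (σ₁ - σ₂)) + M * (h₀ ^ (1 - σ₁) + h₀ ^ (1 - σ₂)) * (c₁ : ℝ)⁻¹ ^ σ₂) := by positivity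
  refine ⟨(A₀ : ℝ) ^ σ₂ * ((A₀ : ℝ) ^ σ₂ * (1 + ((A₀ : ℝ) * (c₁ : ℝ)) ^ (σ₁ - σ₂)) + M * (h₀ ^ (1 - σ₁) + h₀ ^ (1 - σ₂)) * (c₁ : ℝ)⁻¹ ^ σ₂), hK0,
    fun σ hσ₁ hσ₂ g => ?_⟩
  have hσ : 1 < σ := h1.trans_le hσ₁
  have hz : (1 : ℝ) < (((σ : ℝ) : ℂ)).re := by rwa [Complex.ofReal_re]
  -- reduce `g`: `γ₀ g = t k`, `k ∈ Kq`, `t` on the ray at `r ≥ r₀`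
  obtain ⟨γ₀, rr, hrr, t, ht, -, hH, k, hk, hγg⟩ := hred g
  obtain ⟨γ', hγ'⟩ := MonoidHom.mem_range.1 γ₀.2
  -- automorphy: `E(H^σ)(g) = E(H^σ)(γ₀ g) = E(H^σ)(t k)`
  have haut : eisensteinSeriesU (flatSectionU (fun _ : (quasiSplit (↥(maximalRealSubfield L)) L (IsCMField.complexConj L) 2).Adelic => (1 : ℂ)) ((σ : ℝ) : ℂ)) g = eisensteinSeriesU (flatSectionU (fun _ : (quasiSplit (↥(maximalRealSubfield L)) L (IsCMField.complexConj L) 2).Adelic => (1 : ℂ)) ((σ : ℝ) : ℂ)) (((t : ↥(borelAdelic (↥(maximalRealSubfield L)) L (IsCMField.complexConj L) 2)) : (quasiSplit (↥(maximalRealSubfield L)) L (IsCMField.complexConj L) 2).Adelic) * k) := by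
    have h := eisensteinSeriesU_flatSectionU_rational_mul (φ := fun _ : (quasiSplit (↥(maximalRealSubfield L)) L (IsCMField.complexConj L) 2).Adelic => (1 : ℂ)) (fun _ _ _ => rfl) ((σ : ℝ) : ℂ) γ' g
    rw [← hγg, ← hγ', h]
  -- the smear: `H(x·t k) ≤ A₀·H(x·u t)` for every `u ∈ 𝓕 ⊆ 𝓕̄` and every `x`
  have hsm : ∀ u ∈ 𝓕, ∀ x : (quasiSplit (↥(maximalRealSubfield L)) L (IsCMField.complexConj L) 2).Adelic, borelHeight (x * (((t : ↥(borelAdelic (↥(maximalRealSubfield L)) L (IsCMField.complexConj L) 2)) : (quasiSplit (↥(maximalRealSubfield L)) L (IsCMField.complexConj L) 2).Adelic) * k)) ≤ A₀ * borelHeight (x * ((u : (quasiSplit (↥(maximalRealSubfield L)) L (IsCMField.complexConj L) 2).Adelic) * ((t : ↥(borelAdelic (↥(maximalRealSubfield L)) L (IsCMField.complexConj L) 2)) : (quasiSplit (↥(maximalRealSubfield L)) L (IsCMField.complexConj L) 2).Adelic))) := by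
    intro u hu x
    obtain ⟨c', hc', hfac'⟩ := hfac rr hrr t ht k hk u (subset_closure hu)
    rw [hfac', ← mul_assoc x]
    exact (hsmear _ c' hc').1
  -- the constant term of `E(H^σ)` at `t`
  have hCT : borelConstantTerm ν 𝓕 (eisensteinSeriesU (flatSectionU (fun _ : (quasiSplit (↥(maximalRealSubfield L)) L (IsCMField.complexConj L) 2).Adelic => (1 : ℂ)) ((σ : ℝ) : ℂ))) ((t : ↥(borelAdelic (↥(maximalRealSubfield L)) L (IsCMField.complexConj L) 2)) : (quasiSplit (↥(maximalRealSubfield L)) L (IsCMField.complexConj L) 2).Adelic) =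
      1 * ((((borelHeight ((t : ↥(borelAdelic (↥(maximalRealSubfield L)) L (IsCMField.complexConj L) 2)) : (quasiSplit (↥(maximalRealSubfield L)) L (IsCMField.complexConj L) 2).Adelic) : ℝ)) : ℂ) ^ ((σ : ℝ) : ℂ) + c ((σ : ℝ) : ℂ) * (((borelHeight ((t : ↥(borelAdelic (↥(maximalRealSubfield L)) L (IsCMField.complexConj L) 2)) : (quasiSplit (↥(maximalRealSubfield L)) L (IsCMField.complexConj L) 2).Adelic) : ℝ)) : ℂ) ^ (1 - ((σ : ℝ) : ℂ))) := by
    rw [hceq _ hz, borelConstantTerm_sphericalEisenstein_cm_two L ν h𝓕N h𝓕c 1 hz]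
  -- the average: `Σ_q H(γ̃_q t k)^σ ≤ A₀^σ (H(t)^σ + ‖c σ‖ H(t)^{1−σ})`
  have hS := tsum_borelHeight_rpow_le_of_borelConstantTerm L ν h𝓕N h𝓕c hσ hCT hsm
  -- heights: `h₀ ≤ H(t) ≤ A₀·H(t k) ≤ A₀·w₁(g)`, `c₁ ≤ w₁(g)`
  have hHt : h₀ ≤ (borelHeight ((t : ↥(borelAdelic (↥(maximalRealSubfield L)) L (IsCMField.complexConj L) 2)) : (quasiSplit (↥(maximalRealSubfield L)) L (IsCMField.complexConj L) 2).Adelic) : ℝ) := by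
    have h1' : borelHeight ((t : ↥(borelAdelic (↥(maximalRealSubfield L)) L (IsCMField.complexConj L) 2)) : (quasiSplit (↥(maximalRealSubfield L)) L (IsCMField.complexConj L) 2).Adelic) = ((rr : ℝ≥0)) ^ Module.finrank ℚ L * borelHeight (1 : (quasiSplit (↥(maximalRealSubfield L)) L (IsCMField.complexConj L) 2).Adelic) := by rw [← hH 1, mul_one]
    have hle : ((r₀ : ℝ≥0) : ℝ) ≤ ((rr : ℝ≥0) : ℝ) := by exact_mod_cast Units.val_le_val.2 hrr
    rw [hh₀def, h1', NNReal.coe_mul, NNReal.coe_pow]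
    exact mul_le_mul_of_nonneg_right (pow_le_pow_left₀ hr₀.le hle _) (NNReal.coe_nonneg _)
  have hHw : (borelHeight ((t : ↥(borelAdelic (↥(maximalRealSubfield L)) L (IsCMField.complexConj L) 2)) : (quasiSplit (↥(maximalRealSubfield L)) L (IsCMField.complexConj L) 2).Adelic) : ℝ) ≤ (A₀ : ℝ) * (((⨆ γ : (quasiSplit (↥(maximalRealSubfield L)) L (IsCMField.complexConj L) 2).arithmeticSubgroup, borelHeight ((γ : (quasiSplit (↥(maximalRealSubfield L)) L (IsCMField.complexConj L) 2).Adelic) * g)) : ℝ≥0) : ℝ) := by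
    have h1' : borelHeight ((t : ↥(borelAdelic (↥(maximalRealSubfield L)) L (IsCMField.complexConj L) 2)) : (quasiSplit (↥(maximalRealSubfield L)) L (IsCMField.complexConj L) 2).Adelic) ≤ A₀ * borelHeight (((t : ↥(borelAdelic (↥(maximalRealSubfield L)) L (IsCMField.complexConj L) 2)) : (quasiSplit (↥(maximalRealSubfield L)) L (IsCMField.complexConj L) 2).Adelic) * k) := (hsmear _ k (hKqCs hk)).2
    have h2' : borelHeight (((t : ↥(borelAdelic (↥(maximalRealSubfield L)) L (IsCMField.complexConj L) 2)) : (quasiSplit (↥(maximalRealSubfield L)) L (IsCMField.complexConj L) 2).Adelic) * k) ≤ (⨆ γ : (quasiSplit (↥(maximalRealSubfield L)) L (IsCMField.complexConj L) 2).arithmeticSubgroup, borelHeight ((γ : (quasiSplit (↥(maximalRealSubfield L)) L (IsCMField.complexConj L) 2).Adelic) * g)) := by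
      rw [← hγg]
      exact borelHeight_mul_le_ciSup γ₀ g
    exact_mod_cast h1'.trans (mul_le_mul_of_nonneg_left h2' (by positivity))
  have hw : (c₁ : ℝ) ≤ (((⨆ γ : (quasiSplit (↥(maximalRealSubfield L)) L (IsCMField.complexConj L) 2).arithmeticSubgroup, borelHeight ((γ : (quasiSplit (↥(maximalRealSubfield L)) L (IsCMField.complexConj L) 2).Adelic) * g)) : ℝ≥0) : ℝ) := by exact_mod_cast (hw₁ g).le
  -- the positive series at `g` is the one at `t k` (automorphy through `‖E(H^σ)‖`), then §0
  have hSg : (∑' q : Quotient (MulAction.orbitRel ↥(borelU ((IsCMField.complexConj L : L ≃ₐ[↥(maximalRealSubfield L)] L) : L →+* L) ((StdForm.antidiagonal 2).over L)) ↥(unitaryGroupOfForm ((IsCMField.complexConj L : L ≃ₐ[↥(maximalRealSubfield L)] L) : L →+* L) ((StdForm.antidiagonal 2).over L))), ((borelHeight (((quasiSplit (↥(maximalRealSubfield L)) L (IsCMField.complexConj L) 2).toAdelic (Quotient.out q : ↥(unitaryGroupOfForm ((IsCMField.complexConj L : L ≃ₐ[↥(maximalRealSubfield L)] L) : L →+*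 L) ((StdForm.antidiagonal 2).over L)))) * (g)) : ℝ)) ^ σ) = (∑' q : Quotient (MulAction.orbitRel ↥(borelU ((IsCMField.complexConj L : L ≃ₐ[↥(maximalRealSubfield L)] L) : L →+* L) ((StdForm.antidiagonal 2).over L)) ↥(unitaryGroupOfForm ((IsCMField.complexConj L : L ≃ₐ[↥(maximalRealSubfield L)] L) : L →+* L) ((StdForm.antidiagonal 2).over L))), ((borelHeight (((quasiSplit (↥(maximalRealSubfield L)) L (IsCMField.complexConj L) 2).toAdelic (Quotient.out q : ↥(unitaryGroupOfForm ((IsCMField.complexConj L : L ≃ₐ[↥(maximalRealSubfield L)] L) : L →+* L) ((StdForm.antidiagonal 2).over L)))) * ((((t : ↥(borelAdelic (↥(maximalRealSubfield L)) L (IsCMField.complexConj L) 2)) : (quasiSplit (↥(maximalRealSubfield L)) L (IsCMField.complexConj L) 2).Adelic) * k))) : ℝ)) ^ σ) := by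
    have h := congrArg (fun w : ℂ => ‖w‖) haut
    simp only [norm_eisensteinSeriesU_flatSectionU_const_ofReal, norm_one, one_mul] at h
    exact h
  rw [hSg]
  exact compact_majorant_arith h1 hσ₁ hσ₂ hA₀' (norm_nonneg (c ((σ : ℝ) : ℂ))) (hM σ hσ₁ hσ₂) hh₀ hHt hHw hc₁' hw hS

/-- **UNIFORM MAJORANT OF `E(φ₀H^z)` ON `{σ₁ ≤ Re z ≤ σ₂}`** (`1 < σ₁`): `‖E(φ₀H^z)(g)‖ ≤ ‖φ₀‖·C·w₁(g)^{σ₂}` with ONE `C = C(σ₁, σ₂)` for all such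
`z` and all `g` (§1 + `tsum_borelHeight_rpow_le_uniform_cm_two` at `σ = Re z`). [cite: MoeglinWaldspurger1995, II.1.5, IV.1.8] [cite: BernsteinLapid2019, §7] -/
theorem norm_eisensteinSeriesU_flatSectionU_le_uniform_cm_two {δ : L} (hcδ : IsCMField.complexConj L δ = -δ) (hδ : δ ≠ 0)
    (ν : Measure ↥(adelicUnipotent (↥(maximalRealSubfield L)) L (IsCMField.complexConj L) 2)) [ν.IsHaarMeasure] {𝓕 : Set ↥(adelicUnipotent (↥(maximalRealSubfield L)) L (IsCMField.complexConj L) 2)} (h𝓕N : IsFundamentalDomain ↥(rationalUnipotent (↥(maximalRealSubfield L)) L (IsCMField.complexConj L) 2) 𝓕 ν) (h𝓕c : IsCompact (closure 𝓕)) (φ₀ : ℂ) {σ₁ σ₂ : ℝ} (h1 : 1 < σ₁) :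
    ∃ C : ℝ, 0 ≤ C ∧ ∀ z : ℂ, σ₁ ≤ z.re → z.re ≤ σ₂ → ∀ g : (quasiSplit (↥(maximalRealSubfield L)) L (IsCMField.complexConj L) 2).Adelic, ‖eisensteinSeriesU (flatSectionU (fun _ : (quasiSplit (↥(maximalRealSubfield L)) L (IsCMField.complexConj L) 2).Adelic => φ₀) z) g‖ ≤ ‖φ₀‖ * C * (((⨆ γ : (quasiSplit (↥(maximalRealSubfield L)) L (IsCMField.complexConj L) 2).arithmeticSubgroup, borelHeight ((γ : (quasiSplit (↥(maximalRealSubfield L)) L (IsCMField.complexConj L) 2).Adelic) * g)) : ℝ≥0) : ℝ) ^ σ₂ := by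
  obtain ⟨C, hC, h⟩ := tsum_borelHeight_rpow_le_uniform_cm_two L hcδ hδ ν h𝓕N h𝓕c h1
  refine ⟨C, hC, fun z hz₁ hz₂ g => ?_⟩
  rw [mul_assoc]
  exact (norm_eisensteinSeriesU_flatSectionU_const_le L φ₀ (h1.trans_le hz₁) g).trans (mul_le_mul_of_nonneg_left (h z.re hz₁ hz₂ g) (norm_nonneg _))

/-! ## §3 Membership in `𝓗_k(𝔛) = L²(𝔛, w₁^{−2k}dμ)` and the uniform norm bound -/

section Generic

variable {F E : Type} [Field F] [NumberField F] [Field E] [NumberField E] [Algebra F E] {c : E ≃ₐ[F] E} {N : ℕ} [NeZero N]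

/-- **`L²(w₁^{−2k}dμ)`-NORM FROM MODERATE GROWTH** (generic rank, `μ` finite): if `‖Φ(x)‖ ≤ C·w₁(x)^k` for all `x` (`C ≥ 0`, `w₁` Borel) then
`‖Φ‖_{L²(w₁^{−2k}dμ)} ≤ C·μ(𝔛)^{1/2}` — pointwise `w₁^{−2k}·‖Φ‖² ≤ C²`. [cite: BernsteinLapid2019, §4 (p. 10)] [cite: MoeglinWaldspurger1995, I.2.2] -/
theorem eLpNorm_le_of_norm_le_mul_supHeight_pow {μ : Measure (quasiSplit F E c N).automorphicQuotient} [IsFiniteMeasure μ]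
    (hw : Measurable (K2E1BLBorelSpacesU2Defs.supHeight F E c N)) {c₀ : ℝ≥0} (hc₀ : 0 < c₀) (hwc : ∀ x, c₀ ≤ K2E1BLBorelSpacesU2Defs.supHeight F E c N x)
    {Φ : (quasiSplit F E c N).automorphicQuotient → ℂ} {C : ℝ} (hC : 0 ≤ C) {k : ℕ}
    (hmod : ∀ x, ‖Φ x‖ ≤ C * ((K2E1BLBorelSpacesU2Defs.supHeight F E c N x : ℝ)) ^ k) :
    eLpNorm Φ 2 (μ.withDensity fun x => (((K2E1BLBorelSpacesU2Defs.supHeight F E c N x)⁻¹ ^ (2 * k) : ℝ≥0) : ℝ≥0∞)) ≤ ENNReal.ofReal C * (μ univ) ^ (1 / 2 : ℝ) := by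
  have hdm : Measurable fun x => (((K2E1BLBorelSpacesU2Defs.supHeight F E c N x)⁻¹ ^ (2 * k) : ℝ≥0) : ℝ≥0∞) := ((hw.inv).pow_const _).coe_nnreal_ennreal
  rw [eLpNorm_eq_lintegral_rpow_enorm_toReal two_ne_zero ENNReal.ofNat_ne_top, ENNReal.toReal_ofNat,
    lintegral_withDensity_eq_lintegral_mul_non_measurable _ hdm (Eventually.of_forall fun _ => ENNReal.coe_lt_top)]
  -- pointwise `w₁^{−2k}·‖Φ‖² ≤ C²`
  have hpt : ∀ x, ((fun x => (((K2E1BLBorelSpacesU2Defs.supHeight F E c N x)⁻¹ ^ (2 * k) : ℝ≥0) : ℝ≥0∞)) * fun x => (‖Φ x‖ₑ : ℝ≥0∞) ^ (2 : ℝ)) x ≤ ENNReal.ofReal C ^ 2 := by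
    intro x
    set w : ℝ := (K2E1BLBorelSpacesU2Defs.supHeight F E c N x : ℝ) with hwdef
    have hw0 : 0 < w := lt_of_lt_of_le (by exact_mod_cast hc₀) (by exact_mod_cast hwc x)
    have hΦ : ‖Φ x‖ ≤ C * w ^ k := hmod x
    have hreal : (w⁻¹) ^ (2 * k) * ‖Φ x‖ ^ 2 ≤ C ^ 2 := by
      have h1 : ‖Φ x‖ ^ 2 ≤ (C * w ^ k) ^ 2 := pow_le_pow_left₀ (norm_nonneg _) hΦ 2
      have h2 : (w⁻¹) ^ (2 * k) * (C * w ^ k) ^ 2 = C ^ 2 := by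
        rw [mul_pow, ← pow_mul, mul_comm k 2, mul_left_comm, ← mul_pow, inv_mul_cancel₀ hw0.ne', one_pow, mul_one]
      exact (mul_le_mul_of_nonneg_left h1 (by positivity)).trans_eq h2
    show (((K2E1BLBorelSpacesU2Defs.supHeight F E c N x)⁻¹ ^ (2 * k) : ℝ≥0) : ℝ≥0∞) * (‖Φ x‖ₑ : ℝ≥0∞) ^ (2 : ℝ) ≤ ENNReal.ofReal C ^ 2
    rw [ENNReal.rpow_two, ← ofReal_norm, ← ENNReal.ofReal_pow (norm_nonneg _), ← ENNReal.ofReal_coe_nnreal, NNReal.coe_pow, NNReal.coe_inv,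
      ← ENNReal.ofReal_mul (by positivity), ← ENNReal.ofReal_pow hC]
    exact ENNReal.ofReal_le_ofReal hreal
  have hint : ∫⁻ x, ((fun x => (((K2E1BLBorelSpacesU2Defs.supHeight F E c N x)⁻¹ ^ (2 * k) : ℝ≥0) : ℝ≥0∞)) * fun x => (‖Φ x‖ₑ : ℝ≥0∞) ^ (2 : ℝ)) x ∂μ ≤ ENNReal.ofReal C ^ 2 * μ univ := by
    calc ∫⁻ x, ((fun x => (((K2E1BLBorelSpacesU2Defs.supHeight F E c N x)⁻¹ ^ (2 * k) : ℝ≥0) : ℝ≥0∞)) * fun x => (‖Φ x‖ₑ : ℝ≥0∞) ^ (2 : ℝ)) x ∂μ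
        ≤ ∫⁻ _, ENNReal.ofReal C ^ 2 ∂μ := lintegral_mono hpt
      _ = ENNReal.ofReal C ^ 2 * μ univ := lintegral_const _
  calc (∫⁻ x, ((fun x => (((K2E1BLBorelSpacesU2Defs.supHeight F E c N x)⁻¹ ^ (2 * k) : ℝ≥0) : ℝ≥0∞)) * fun x => (‖Φ x‖ₑ : ℝ≥0∞) ^ (2 : ℝ)) x ∂μ) ^ (1 / 2 : ℝ)
      ≤ (ENNReal.ofReal C ^ 2 * μ univ) ^ (1 / 2 : ℝ) := ENNReal.rpow_le_rpow hint (by norm_num)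
    _ = ENNReal.ofReal C * (μ univ) ^ (1 / 2 : ℝ) := by
      rw [ENNReal.mul_rpow_of_nonneg _ _ (by norm_num : (0 : ℝ) ≤ 1 / 2), show (1 / 2 : ℝ) = ((2 : ℕ) : ℝ)⁻¹ by norm_num,
        ENNReal.pow_rpow_inv_natCast two_ne_zero]

/-- The norm of the `𝓗_k(𝔛)`-element ★ leaf `toHX k μ φ hφ` is the `L²(w₁^{−2k}dμ)`-norm of `quotFun φ`; with moderate growth `‖φ(x̃⁻¹)‖ ≤ C·w₁(x)^k`
it is at most `C·μ(𝔛)^{1/2}`. [cite: BernsteinLapid2019, §4 (p. 10)] -/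
theorem norm_toHX_le_of_norm_le_mul_supHeight_pow {μ : Measure (quasiSplit F E c N).automorphicQuotient} [IsFiniteMeasure μ]
    (hw : Measurable (K2E1BLBorelSpacesU2Defs.supHeight F E c N)) {c₀ : ℝ≥0} (hc₀ : 0 < c₀) (hwc : ∀ x, c₀ ≤ K2E1BLBorelSpacesU2Defs.supHeight F E c N x)
    {k : ℕ} {φ : (quasiSplit F E c N).Adelic → ℂ}
    (hφ : MemLp ((quasiSplit F E c N).quotFun φ) 2 (μ.withDensity fun x => (((K2E1BLBorelSpacesU2Defs.supHeight F E c N x)⁻¹ ^ (2 * k) : ℝ≥0) : ℝ≥0∞)))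
    {C : ℝ} (hC : 0 ≤ C) (hmod : ∀ x, ‖(quasiSplit F E c N).quotFun φ x‖ ≤ C * ((K2E1BLBorelSpacesU2Defs.supHeight F E c N x : ℝ)) ^ k) :
    ‖K2E1BLBorelSpacesU2Defs.toHX F E c N k μ φ hφ‖ ≤ C * ((μ univ) ^ (1 / 2 : ℝ)).toReal := by
  have hfin : ENNReal.ofReal C * (μ univ) ^ (1 / 2 : ℝ) ≠ ∞ :=
    ENNReal.mul_ne_top ENNReal.ofReal_ne_top (ENNReal.rpow_ne_top_of_nonneg (by norm_num) (measure_ne_top μ _))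
  unfold K2E1BLBorelSpacesU2Defs.toHX
  rw [Lp.norm_toLp, ← ENNReal.toReal_ofReal hC, ← ENNReal.toReal_mul]
  exact ENNReal.toReal_mono hfin (eLpNorm_le_of_norm_le_mul_supHeight_pow hw hc₀ hwc hC hmod)

end Generic

/-- `E(φ₀H^z)` (`Re z > 1`) is left-`G(F)`-invariant, so its descent `quotFun` to `𝔛` is Borel (★ `continuous_eisensteinSeriesU_flatSectionU_cm_two`, ★
`measurable_quotFun_of_measurable`). [cite: MoeglinWaldspurger1995, I.2.13, II.1.5] -/
theorem measurable_quotFun_eisensteinSeriesU_cm_two (φ₀ : ℂ) {z : ℂ} (hz : 1 < z.re) :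
    Measurable ((quasiSplit (↥(maximalRealSubfield L)) L (IsCMField.complexConj L) 2).quotFun (eisensteinSeriesU (flatSectionU (fun _ : (quasiSplit (↥(maximalRealSubfield L)) L (IsCMField.complexConj L) 2).Adelic => φ₀) z))) := by
  have hEc := continuous_eisensteinSeriesU_flatSectionU_cm_two L hz (φ := fun _ : (quasiSplit (↥(maximalRealSubfield L)) L (IsCMField.complexConj L) 2).Adelic => φ₀) continuous_const (M := ‖φ₀‖) (fun _ => le_rfl)
  refine measurable_quotFun_of_measurable hEc.measurable fun γ x => ?_
  obtain ⟨γ', hγ'⟩ := MonoidHom.mem_range.1 γ.2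
  rw [← hγ']
  exact eisensteinSeriesU_flatSectionU_rational_mul (φ := fun _ : (quasiSplit (↥(maximalRealSubfield L)) L (IsCMField.complexConj L) 2).Adelic => φ₀) (fun _ _ _ => rfl) z γ' x

/-- **(b1) `E(φ₀H^z) ∈ 𝓗_k(𝔛)` FOR `1 < Re z ≤ k`, LETTER-FREE.**  On `U(1,1)_{L/L⁺}` (CM pair), for every finite Borel measure `μ` on `𝔛 = G(F)∖G(𝔸)`,
every `φ₀`, every `k : ℕ` and every `z` with `1 < Re z ≤ k`: `quotFun E(φ₀H^z) ∈ L²(𝔛, w₁^{−2k}dμ)` — ★ FILE C `memLp_two_withDensity_supHeight_of_norm_le_mul_pow`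
with `hw :=` ★ `measurable_supHeight`, the floor `c₀ ≤ w₁` of ★ `exists_pos_forall_le_supHeight_cm`, and `hmod :=` §2 at `σ₁ = Re z`, `σ₂ = k`, `g = x̃⁻¹`
(`w₁(x̃⁻¹) = supHeight x`, ★ `supHeight_eq_ciSup_arithmetic`). The remaining inputs `δ` (a nonzero trace-zero element of `L/L⁺`) and `(ν, 𝓕)` (Haar measure and
relatively compact fundamental domain of `N(F)∖N(𝔸)`) are CHOICES feeding ★ W5-B, not hypotheses on `E`. [cite: BernsteinLapid2019, §4 (p. 10), §7]
[cite: MoeglinWaldspurger1995, II.1.5, IV.1.8] -/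
theorem eisensteinSeriesU_flatSectionU_memHX_cm_two {δ : L} (hcδ : IsCMField.complexConj L δ = -δ) (hδ : δ ≠ 0)
    (ν : Measure ↥(adelicUnipotent (↥(maximalRealSubfield L)) L (IsCMField.complexConj L) 2)) [ν.IsHaarMeasure] {𝓕 : Set ↥(adelicUnipotent (↥(maximalRealSubfield L)) L (IsCMField.complexConj L) 2)} (h𝓕N : IsFundamentalDomain ↥(rationalUnipotent (↥(maximalRealSubfield L)) L (IsCMField.complexConj L) 2) 𝓕 ν) (h𝓕c : IsCompact (closure 𝓕)) (μ : Measure (quasiSplit (↥(maximalRealSubfield L)) L (IsCMField.complexConj L) 2).automorphicQuotient) [IsFiniteMeasure μ] (φ₀ : ℂ) (k : ℕ) {z : ℂ} (hz : 1 < z.re) (hzk : z.re ≤ k) :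
    MemLp ((quasiSplit (↥(maximalRealSubfield L)) L (IsCMField.complexConj L) 2).quotFun (eisensteinSeriesU (flatSectionU (fun _ : (quasiSplit (↥(maximalRealSubfield L)) L (IsCMField.complexConj L) 2).Adelic => φ₀) z))) 2 (μ.withDensity fun x => (((K2E1BLBorelSpacesU2Defs.supHeight (↥(maximalRealSubfield L)) L (IsCMField.complexConj L) 2 x)⁻¹ ^ (2 * k) : ℝ≥0) : ℝ≥0∞)) := by
  obtain ⟨C, hC, hmaj⟩ := norm_eisensteinSeriesU_flatSectionU_le_uniform_cm_two L hcδ hδ ν h𝓕N h𝓕c φ₀ hz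
  obtain ⟨c₀, hc₀, hwc⟩ := exists_pos_forall_le_supHeight_cm L
  refine memLp_two_withDensity_supHeight_of_norm_le_mul_pow measurable_supHeight hc₀ hwc
    (measurable_quotFun_eisensteinSeriesU_cm_two L φ₀ hz).aestronglyMeasurable (C := ‖φ₀‖ * C) (n := k) (fun x => ?_) le_rfl
  rw [supHeight_eq_ciSup_arithmetic, ← Real.rpow_natCast]
  exact hmaj z le_rfl hzk (Quotient.out (x : (quasiSplit (↥(maximalRealSubfield L)) L (IsCMField.complexConj L) 2).Adelic ⧸ (quasiSplit (↥(maximalRealSubfield L)) L (IsCMField.complexConj L) 2).quotientSubgroup))⁻¹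

/-- **THE `𝓗_k(𝔛)`-NORM OF `E(φ₀H^z)` IS BOUNDED UNIFORMLY ON `{σ₁ ≤ Re z ≤ k}`** (`1 < σ₁ ≤ k`): ONE constant `C` with
`‖toHX k μ E(φ₀H^z)‖ ≤ C` for all such `z` — the uniform majorant §2 on `[σ₁, k]` and `norm_toHX_le_of_norm_le_mul_supHeight_pow`. This is the domination
input of (b2) (holomorphy of `z ↦ ι E(φ₀H^z)` in `𝓗_N`). [cite: BernsteinLapid2019, §4 (p. 10), §7] [cite: MoeglinWaldspurger1995, IV.1.8] -/
theorem norm_toHX_eisensteinSeriesU_le_uniform_cm_two {δ : L} (hcδ : IsCMField.complexConj L δ = -δ) (hδ : δ ≠ 0)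
    (ν : Measure ↥(adelicUnipotent (↥(maximalRealSubfield L)) L (IsCMField.complexConj L) 2)) [ν.IsHaarMeasure] {𝓕 : Set ↥(adelicUnipotent (↥(maximalRealSubfield L)) L (IsCMField.complexConj L) 2)} (h𝓕N : IsFundamentalDomain ↥(rationalUnipotent (↥(maximalRealSubfield L)) L (IsCMField.complexConj L) 2) 𝓕 ν) (h𝓕c : IsCompact (closure 𝓕)) (μ : Measure (quasiSplit (↥(maximalRealSubfield L)) L (IsCMField.complexConj L) 2).automorphicQuotient) [IsFiniteMeasure μ] (φ₀ : ℂ) (k : ℕ) {σ₁ : ℝ} (h1 : 1 < σ₁) :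
    ∃ C : ℝ, 0 ≤ C ∧ ∀ z : ℂ, ∀ hz : σ₁ ≤ z.re, ∀ hzk : z.re ≤ k,
      ‖K2E1BLBorelSpacesU2Defs.toHX (↥(maximalRealSubfield L)) L (IsCMField.complexConj L) 2 k μ (eisensteinSeriesU (flatSectionU (fun _ : (quasiSplit (↥(maximalRealSubfield L)) L (IsCMField.complexConj L) 2).Adelic => φ₀) z))
          (eisensteinSeriesU_flatSectionU_memHX_cm_two L hcδ hδ ν h𝓕N h𝓕c μ φ₀ k (h1.trans_le hz) hzk)‖ ≤ C := by
  obtain ⟨C, hC, hmaj⟩ := norm_eisensteinSeriesU_flatSectionU_le_uniform_cm_two L hcδ hδ ν h𝓕N h𝓕c φ₀ h1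
  obtain ⟨c₀, hc₀, hwc⟩ := exists_pos_forall_le_supHeight_cm L
  refine ⟨‖φ₀‖ * C * ((μ univ) ^ (1 / 2 : ℝ)).toReal, by positivity, fun z hz hzk => ?_⟩
  refine norm_toHX_le_of_norm_le_mul_supHeight_pow measurable_supHeight hc₀ hwc _ (mul_nonneg (norm_nonneg _) hC) fun x => ?_
  rw [supHeight_eq_ciSup_arithmetic, ← Real.rpow_natCast]
  exact hmaj z hz hzk (Quotient.out (x : (quasiSplit (↥(maximalRealSubfield L)) L (IsCMField.complexConj L) 2).Adelic ⧸ (quasiSplit (↥(maximalRealSubfield L)) L (IsCMField.complexConj L) 2).quotientSubgroup))⁻¹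

end Summit.HodgeConjecture.HodgeConjecture.Cruxes.H413.K2E1BLEisensteinMemHXCMTwo
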